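import Literature.Analysis.FluidPDE.TaoForcedFiniteEnergyLerayHopf
import Literature.Analysis.FluidPDE.ForcePotentialL2Bound
import Literature.Analysis.FluidPDE.NSLerayHopf
import Literature.Analysis.FluidPDE.ForcedSerrinMasudaUniqueness
import Summits.NavierStokesRegularity.FluidComputer.ClayForceSliceBounds
import HarnessLib

/-!
# Clay-class forces: every finite-energy classical solution of forced Navier–Stokes is Leray–Hopf
# (the `hu` / `hw` inputs of the forced Serrin–Masuda weak–strong uniqueness, PATH B)

HONEST FRAMING (cell `ns-blowup`, seat `ns-blowup-ecbridge-2` g2, human ruling D-0035; PATH B of the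
`E–C` endpoint, LIT-DOSSIER §41 / planner WORD STATUS l.1312). WHAT THIS IS NOT: not NS — no
construction, no blow-up claim; regularity bookkeeping WITH force. Everything here is CONDITIONAL on
the two printed forced facts of `Literature/Analysis/FluidPDE/TaoForcedNormalisedPressure.lean`
(Tao 2011 Lemma 4.1 (i) `tao2011_forced_pressure_normalisation` and Lemma 8.1
`tao2011_forced_finiteEnergy_energyBound`, taken as hypotheses `hP`, `hL`) and on nothing else.

Fefferman's force class (C) — `IsSmoothOnHalfSpace f ∧ HasRapidSpaceTimeDecay f` — supplies, slab by
slab, the two slice hypotheses of the Literature theorem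
`IsClassicalNSSolutionOn.isLerayHopfOn_of_finiteEnergy_forced` (`TaoForcedFiniteEnergyLerayHopf`):

* `clayForce_slice_sup_L1` — `‖f(t,x)‖ ≤ M` and `∫⁻ ‖f t‖ₑ ≤ N < ∞` uniformly in `t ≥ 0` (decay
  `(1+|x|)⁻⁴`, `4 > 3`), the slices being continuous (`continuous_slice_of_isSmoothOnHalfSpace`);
* `clayForce_forcePotential_bounds` — the force potential `Δ⁻¹∇·f(t)` is a.e. strongly measurable with
  `∫⁻ ‖Δ⁻¹∇·f(t)‖ₑ² ≤ Π < ∞` uniformly in `t ≥ 0` (`ForcePotentialL2Bound.eLpNorm_forcePotential_le`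
  with the uniform `L¹`, `L²`, `L^∞` slice bounds; `L²` from `ClayForceSliceBounds`);

whence THE PACKAGE:

* `isLerayHopfOn_of_clayForce` — `hP → hL →` classical solution of forced NS on `[0,T] × ℝ³` with
  `sup_t ∫|u(t)|² < ∞` and Clay-class `f` ⇒ `IsLerayHopfOn T ν f (u 0) u ∧ ContinuousInLpOn (Icc 0 T) 2 u`;
* `isGlobalLerayHopf_of_claySolution` — `hP → hL →` a Clay solution on `[0,∞)` (Fefferman (1)–(3),
  (6)–(7): `IsNavierStokesSolution ν f u₀ u p`, `u, p` smooth on the half-space, `HasBoundedEnergy u`)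
  with Clay-class `f` is a global Leray–Hopf solution `IsGlobalLerayHopf ν f u₀ u` — exactly the
  competitor input `hu` of `sohr2001_serrinMasuda_uniqueness_forced` (`ForcedSerrinMasudaUniqueness`);
  the designed solution of a `Realisation` gets `hw` from `isLerayHopfOn_of_clayForce` on each
  `[0,T']`, `T' < T`;
* `clayForce_memLqLp_one_two` — the force-class input `f ∈ L¹(0,T';L²)` of the Serrin–Masuda fact;
* `clay_competitor_eq_of_serrinClass` — THE PATH B CLOSING LEMMA (generic, no route structure):
  `hSM → hP → hL →` a Clay solution `(v, r)` on `[0,∞)` from the datum `w 0` COINCIDES on `[0,T] × ℝ³`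
  with any finite-energy classical solution `(w, q)` of the same forced system on `[0,T]` that lies in
  `L⁴(0,T'; L⁶)` for every `T' < T` (`hSM = sohr2001_serrinMasuda_uniqueness_forced`, Sohr V.1.5.1) —
  the route's bridge variant `navierStokesBreakdownR3_of_realisation_ws` is this lemma applied to the
  `Realisation`'s designed solution plus its blow-up clause.
-/

noncomputable section

namespace Summit.NavierStokesRegularity.FluidComputer.ClayForcedLerayHopf

open Set MeasureTheory Function Filter Topology Metric Literature.Analysis.FluidPDE
  Summit.NavierStokesRegularity.FluidComputer.ClayForceSliceBounds
open scoped ENNReal NNReal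

variable {E : Type*} [NormedAddCommGroup E] [InnerProductSpace ℝ E]
variable {F : Type*} [NormedAddCommGroup F] [NormedSpace ℝ F]

/-- The slices `f t`, `t ≥ 0`, of a field smooth on the closed half-space are continuous. -/
theorem continuous_slice_of_isSmoothOnHalfSpace {f : ℝ → E → F} (hs : IsSmoothOnHalfSpace f)
    {t : ℝ} (ht : 0 ≤ t) : Continuous (f t) :=
  continuous_iff_continuousAt.2 fun x => (hasFDerivAt_slice_of_isSmoothOnHalfSpace hs ht x).continuousAt

/-- On `ℝ³`: a continuous field dominated by `C / (1 + ‖x‖)⁴` is integrable, quantitatively: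
`∫⁻ ‖g‖ₑ ≤ ofReal C · ∫ (1 + ‖x‖)^{-4} < ∞` (`4 > 3 = dim`). -/
theorem lintegral_enorm_le_of_norm_le_inv_pow_four {G : Type*} [NormedAddCommGroup G]
    {g : EuclideanSpace ℝ (Fin 3) → G} {C : ℝ} (hC : 0 ≤ C)
    (hg : ∀ x, ‖g x‖ ≤ C / (1 + ‖x‖) ^ 4) :
    ∫⁻ x, ‖g x‖ₑ ≤
      ENNReal.ofReal C * ∫⁻ x : EuclideanSpace ℝ (Fin 3), ENNReal.ofReal ((1 + ‖x‖) ^ (-(4 : ℝ))) ∧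
    ∫⁻ x : EuclideanSpace ℝ (Fin 3), ENNReal.ofReal ((1 + ‖x‖) ^ (-(4 : ℝ))) < ⊤ := by
  refine ⟨?_, finite_integral_one_add_norm (by rw [finrank_euclideanSpace_fin]; norm_num)⟩
  rw [← lintegral_const_mul' _ _ ENNReal.ofReal_ne_top]
  refine lintegral_mono fun x => ?_
  have h1 : 0 < 1 + ‖x‖ := by positivity
  have hle : ‖g x‖ ≤ C * (1 + ‖x‖) ^ (-(4 : ℝ)) := by
    rw [Real.rpow_neg h1.le, show (4 : ℝ) = ((4 : ℕ) : ℝ) by norm_num, Real.rpow_natCast,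
      ← div_eq_mul_inv]
    exact hg x
  calc ‖g x‖ₑ = ENNReal.ofReal ‖g x‖ := (ofReal_norm _).symm
    _ ≤ ENNReal.ofReal (C * (1 + ‖x‖) ^ (-(4 : ℝ))) := ENNReal.ofReal_le_ofReal hle
    _ = ENNReal.ofReal C * ENNReal.ofReal ((1 + ‖x‖) ^ (-(4 : ℝ))) := ENNReal.ofReal_mul hC

/-- **Uniform sup and `L¹` bounds of the slices of a Clay-class force**: there are `M : ℝ` and
`N : ℝ≥0∞`, `N < ⊤`, with `‖f t x‖ ≤ M` and `∫⁻ ‖f t‖ₑ ≤ N` for all `t ≥ 0`; each slice is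
integrable. -/
theorem clayForce_slice_sup_L1 {f : ℝ → EuclideanSpace ℝ (Fin 3) → EuclideanSpace ℝ (Fin 3)}
    (hs : IsSmoothOnHalfSpace f) (hd : HasRapidSpaceTimeDecay f) :
    ∃ (M : ℝ) (N : ℝ≥0∞), N < ⊤ ∧ ∀ t, 0 ≤ t →
      (∀ x, ‖f t x‖ ≤ M) ∧ Integrable (f t) ∧ ∫⁻ x, ‖f t x‖ₑ ≤ N := by
  obtain ⟨C, hC0, hC⟩ := norm_slice_le_of_hasRapidSpaceTimeDecay hd 4
  set J : ℝ≥0∞ := ∫⁻ x : EuclideanSpace ℝ (Fin 3), ENNReal.ofReal ((1 + ‖x‖) ^ (-(4 : ℝ))) with hJ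
  have hJ' : J < ⊤ := (lintegral_enorm_le_of_norm_le_inv_pow_four hC0 (hC 0 le_rfl)).2
  refine ⟨C, ENNReal.ofReal C * J, ENNReal.mul_lt_top ENNReal.ofReal_lt_top hJ', fun t ht => ?_⟩
  have hsup : ∀ x, ‖f t x‖ ≤ C := fun x => (hC t ht x).trans
    (div_le_self hC0 (one_le_pow₀ (by linarith [norm_nonneg x])))
  have hL1 := (lintegral_enorm_le_of_norm_le_inv_pow_four hC0 (hC t ht)).1
  refine ⟨hsup, ⟨(continuous_slice_of_isSmoothOnHalfSpace hs ht).aestronglyMeasurable, ?_⟩, hL1⟩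
  exact hL1.trans_lt (ENNReal.mul_lt_top ENNReal.ofReal_lt_top hJ')

/-- `(∫⁻ ‖g‖ₑ²)^{1/2} = ‖g‖_{L²}` (natural-number square). -/
theorem eLpNorm_two_eq_sqrt_lintegral {G : Type*} [NormedAddCommGroup G] {X : Type*}
    [MeasurableSpace X] {μ : Measure X} (g : X → G) :
    eLpNorm g 2 μ = (∫⁻ x, ‖g x‖ₑ ^ 2 ∂μ) ^ (1 / 2 : ℝ) := by
  rw [eLpNorm_eq_lintegral_rpow_enorm_toReal two_ne_zero ENNReal.ofNat_ne_top]
  have h2 : (2 : ℝ≥0∞).toReal = 2 := by norm_num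
  rw [h2]
  simp only [ENNReal.rpow_two]

/-- **Uniform `L²` bound of the force potential of a Clay-class force**: there is `Π < ⊤` with
`Δ⁻¹∇·f(t)` a.e. strongly measurable and `∫⁻ ‖Δ⁻¹∇·f(t)‖ₑ² ≤ Π` for all `t ≥ 0`
(`eLpNorm_forcePotential_le`: `‖Δ⁻¹∇·g‖₂ ≤ ‖κ₁‖₁‖g‖₂ + ‖g‖₁‖κ₂‖₂` with the uniform slice bounds). -/
theorem clayForce_forcePotential_bounds
    {f : ℝ → EuclideanSpace ℝ (Fin 3) → EuclideanSpace ℝ (Fin 3)}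
    (hs : IsSmoothOnHalfSpace f) (hd : HasRapidSpaceTimeDecay f) :
    ∃ Pf : ℝ≥0∞, Pf < ⊤ ∧ ∀ t, 0 ≤ t →
      AEStronglyMeasurable (forcePotential (f t)) volume ∧
        ∫⁻ x, ‖forcePotential (f t) x‖ₑ ^ 2 ≤ Pf := by
  obtain ⟨M, N, hNt, hMN⟩ := clayForce_slice_sup_L1 hs hd
  obtain ⟨⟨C₀, hC₀⟩, -⟩ := clayForce_slice_bounds hs hd
  -- the two universal kernel constants
  set K₁ : ℝ≥0∞ := ∫⁻ z, ‖(ball (0 : EuclideanSpace ℝ (Fin 3)) 1).indicator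
    (fun z : EuclideanSpace ℝ (Fin 3) => (4 * Real.pi * ‖z‖ ^ 2)⁻¹) z‖ₑ with hK₁
  set K₂ : ℝ≥0∞ := eLpNorm ((ball (0 : EuclideanSpace ℝ (Fin 3)) 1)ᶜ.indicator
    fun z : EuclideanSpace ℝ (Fin 3) => (4 * Real.pi * ‖z‖ ^ 2)⁻¹) 2 volume with hK₂
  have hK₁t : K₁ < ⊤ := integrable_forceMajorant_near.2
  have hK₂t : K₂ < ⊤ := memLp_forceMajorant_far.eLpNorm_lt_top
  set P : ℝ≥0∞ := K₁ * (C₀ : ℝ≥0∞) ^ (1 / 2 : ℝ) + N * K₂ with hP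
  have hPt : P < ⊤ := ENNReal.add_lt_top.2
    ⟨ENNReal.mul_lt_top hK₁t (ENNReal.rpow_lt_top_of_nonneg (by norm_num) ENNReal.coe_ne_top),
      ENNReal.mul_lt_top hNt hK₂t⟩
  refine ⟨P ^ 2, ENNReal.pow_lt_top hPt, fun t ht => ?_⟩
  obtain ⟨hsup, hint, hL1⟩ := hMN t ht
  have hcont : Continuous (f t) := continuous_slice_of_isSmoothOnHalfSpace hs ht
  refine ⟨aestronglyMeasurable_forcePotential hcont.measurable, ?_⟩
  have h2 : eLpNorm (f t) 2 volume ≤ (C₀ : ℝ≥0∞) ^ (1 / 2 : ℝ) := by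
    rw [eLpNorm_two_eq_sqrt_lintegral]
    gcongr
    exact hC₀ t ht
  have hle : eLpNorm (forcePotential (f t)) 2 volume ≤ P :=
    (eLpNorm_forcePotential_le hcont hint hsup).trans (by rw [hP]; gcongr)
  calc ∫⁻ x, ‖forcePotential (f t) x‖ₑ ^ 2
      = (eLpNorm (forcePotential (f t)) 2 volume) ^ 2 := by
        rw [eLpNorm_two_eq_sqrt_lintegral, ← ENNReal.rpow_natCast, ← ENNReal.rpow_mul]
        norm_num
    _ ≤ P ^ 2 := by gcongr

/-- **Finite-energy classical solutions of forced Navier–Stokes with a Clay-class force are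
Leray–Hopf** (Tao 2011 Lemma 8.1 sharp form + Lemma 4.1 (i), both WITH force — hypotheses `hP`,
`hL`): on every slab `[0, T]`, `IsLerayHopfOn T ν f (u 0) u` (energy equality with the work term
`∫⟪f,u⟫`) and `u ∈ C([0,T]; L²)`. This is the input `hw` (designed solution, slab by slab) of
`sohr2001_serrinMasuda_uniqueness_forced`. -/
theorem isLerayHopfOn_of_clayForce
    {T ν : ℝ} {f u : ℝ → EuclideanSpace ℝ (Fin 3) → EuclideanSpace ℝ (Fin 3)}
    {p : ℝ → EuclideanSpace ℝ (Fin 3) → ℝ}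
    (hP : tao2011_forced_pressure_normalisation) (hL : tao2011_forced_finiteEnergy_energyBound)
    (h : IsClassicalNSSolutionOn (Icc 0 T) ν f u p) (hν : 0 < ν) (hT : 0 < T)
    (hs : IsSmoothOnHalfSpace f) (hd : HasRapidSpaceTimeDecay f)
    (hfe : ∃ A : ℝ≥0∞, A < ⊤ ∧ ∀ t ∈ Icc 0 T, ∫⁻ x, ‖u t x‖ₑ ^ 2 ≤ A) :
    IsLerayHopfOn T ν f (u 0) u ∧ ContinuousInLpOn (Icc 0 T) 2 u := by
  obtain ⟨⟨C₀, hC₀⟩, -⟩ := clayForce_slice_bounds hs hd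
  obtain ⟨Pf, hPft, hPf⟩ := clayForce_forcePotential_bounds hs hd
  exact h.isLerayHopfOn_of_finiteEnergy_forced hP hL hν hT (Cf := (C₀ : ℝ≥0∞)) ENNReal.coe_ne_top
    (fun t ht => hC₀ t ht.1) hPft.ne (fun t ht => (hPf t ht.1).1) (fun t ht => (hPf t ht.1).2) hfe

/-- **A Clay solution on `[0, ∞)` is a global Leray–Hopf solution** (hypotheses `hP`, `hL`): for
`ν > 0`, a Clay-class force `f`, and `(u, p)` smooth on `[0,∞) × ℝ³` solving Fefferman's (1)–(3)
from `u₀` with bounded energy (7), `u` is Leray–Hopf on every `[0, T)` from `u₀` WITH force `f`.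
This is the competitor input `hu` of `sohr2001_serrinMasuda_uniqueness_forced` in the PATH B closing
argument of the `E–C` route. -/
theorem isGlobalLerayHopf_of_claySolution
    {ν : ℝ} {f u : ℝ → EuclideanSpace ℝ (Fin 3) → EuclideanSpace ℝ (Fin 3)}
    {u₀ : EuclideanSpace ℝ (Fin 3) → EuclideanSpace ℝ (Fin 3)} {p : ℝ → EuclideanSpace ℝ (Fin 3) → ℝ}
    (hP : tao2011_forced_pressure_normalisation) (hL : tao2011_forced_finiteEnergy_energyBound)
    (hν : 0 < ν) (hs : IsSmoothOnHalfSpace f) (hd : HasRapidSpaceTimeDecay f)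
    (hsol : IsNavierStokesSolution ν f u₀ u p) (hu : IsSmoothOnHalfSpace u)
    (hp : IsSmoothOnHalfSpace p) (hE : HasBoundedEnergy u) :
    IsGlobalLerayHopf ν f u₀ u ∧ ∀ T, 0 < T → ContinuousInLpOn (Icc 0 T) 2 u := by
  obtain ⟨hcl, h0⟩ := isNavierStokesSolution_and_smooth_iff.1 ⟨hsol, hu, hp⟩
  obtain ⟨A, hAt, hA⟩ := hE
  have key : ∀ T, 0 < T → IsLerayHopfOn T ν f u₀ u ∧ ContinuousInLpOn (Icc 0 T) 2 u := by
    intro T hT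
    have hT' : IsClassicalNSSolutionOn (Icc 0 T) ν f u p :=
      hcl.mono Icc_subset_Ici_self (uniqueDiffOn_Icc hT)
    have hfe : ∃ A : ℝ≥0∞, A < ⊤ ∧ ∀ t ∈ Icc 0 T, ∫⁻ x, ‖u t x‖ₑ ^ 2 ≤ A :=
      ⟨A, hAt, fun t ht => hA t ht.1⟩
    rw [← h0]
    exact isLerayHopfOn_of_clayForce hP hL hT' hν hT hs hd hfe
  exact ⟨fun T hT => (key T hT).1, fun T hT => (key T hT).2⟩

/-- **The force-class input of the Serrin–Masuda fact**: a Clay-class force lies in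
`L¹(0,T'; L²(ℝ³))` for every `T'` (slices continuous with `∫|f(t)|² ≤ C₀` for `t ≥ 0`). -/
theorem clayForce_memLqLp_one_two
    {f : ℝ → EuclideanSpace ℝ (Fin 3) → EuclideanSpace ℝ (Fin 3)}
    (hs : IsSmoothOnHalfSpace f) (hd : HasRapidSpaceTimeDecay f) (T' : ℝ) :
    MemLqLp 1 2 f (Ioo 0 T') := by
  obtain ⟨⟨C₀, hC₀⟩, -⟩ := clayForce_slice_bounds hs hd
  have hmem : ∀ t, 0 ≤ t → MemLp (f t) 2 volume := fun t ht =>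
    memLp_two_of_lintegral_lt_top (continuous_slice_of_isSmoothOnHalfSpace hs ht)
      ((hC₀ t ht).trans_lt ENNReal.coe_lt_top)
  refine ⟨(ae_restrict_iff' measurableSet_Ioo).2 (Eventually.of_forall fun t ht => hmem t ht.1.le), ?_⟩
  rw [eLqLpNorm, eLpNorm_one_eq_lintegral_enorm]
  have hb : ∀ t ∈ Ioo 0 T', ‖(eLpNorm (f t) 2 volume).toReal‖ₑ ≤ (C₀ : ℝ≥0∞) ^ (1 / 2 : ℝ) := by
    intro t ht
    rw [Real.enorm_eq_ofReal ENNReal.toReal_nonneg, ENNReal.ofReal_toReal (hmem t ht.1.le).eLpNorm_ne_top,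
      eLpNorm_two_eq_sqrt_lintegral]
    gcongr
    exact hC₀ t ht.1.le
  calc ∫⁻ t in Ioo 0 T', ‖(eLpNorm (f t) 2 volume).toReal‖ₑ
      ≤ ∫⁻ t in Ioo 0 T', (C₀ : ℝ≥0∞) ^ (1 / 2 : ℝ) := setLIntegral_mono' measurableSet_Ioo hb
    _ = (C₀ : ℝ≥0∞) ^ (1 / 2 : ℝ) * volume (Ioo 0 T') := setLIntegral_const _ _
    _ < ⊤ := by
        rw [Real.volume_Ioo]
        exact ENNReal.mul_lt_top (ENNReal.rpow_lt_top_of_nonneg (by norm_num) ENNReal.coe_ne_top)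
          ENNReal.ofReal_lt_top

/-- **THE PATH B CLOSING LEMMA (generic form).** GIVEN the three printed forced facts — Sohr's
Serrin–Masuda weak–strong uniqueness `sohr2001_serrinMasuda_uniqueness_forced` (`hSM`), Tao's
Lemma 4.1 (i) `tao2011_forced_pressure_normalisation` (`hP`) and Lemma 8.1
`tao2011_forced_finiteEnergy_energyBound` (`hL`) — let `f` be a Clay-class force, `(w, q)` a classical
solution of the forced system on the closed slab `[0, T] × ℝ³` with `sup_t ∫|w(t)|² < ∞` lying in the
Serrin class `L⁴(0,T'; L⁶)` for every `T' < T` (the DESIGNED solution), and `(v, r)` ANY Clay solution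
on `[0, ∞)` (Fefferman (1)–(3), (6)–(7)) from the same datum `w 0`. Then `v = w` on `[0, T] × ℝ³`.
Proof: both are Leray–Hopf on `[0,T)` from `w 0` WITH force `f` (`isGlobalLerayHopf_of_claySolution`,
`isLerayHopfOn_of_clayForce`), Serrin–Masuda gives `w(t) = v(t)` a.e. for `t ∈ (0,T)`, continuity in
`x` upgrades a.e. to everywhere, and joint continuity in `t` extends to `t = 0, T`. -/
theorem clay_competitor_eq_of_serrinClass
    {ν T : ℝ} {f w v : ℝ → EuclideanSpace ℝ (Fin 3) → EuclideanSpace ℝ (Fin 3)}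
    {q r : ℝ → EuclideanSpace ℝ (Fin 3) → ℝ}
    (hSM : sohr2001_serrinMasuda_uniqueness_forced)
    (hP : tao2011_forced_pressure_normalisation) (hL : tao2011_forced_finiteEnergy_energyBound)
    (hν : 0 < ν) (hT : 0 < T) (hs : IsSmoothOnHalfSpace f) (hd : HasRapidSpaceTimeDecay f)
    (hw : IsClassicalNSSolutionOn (Icc 0 T) ν f w q)
    (hwE : ∃ A : ℝ≥0∞, A < ⊤ ∧ ∀ t ∈ Icc 0 T, ∫⁻ x, ‖w t x‖ₑ ^ 2 ≤ A)
    (hS : ∀ T', 0 < T' → T' < T → MemLqLp 4 6 w (Ioo 0 T'))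
    (hsol : IsNavierStokesSolution ν f (w 0) v r) (hv : IsSmoothOnHalfSpace v)
    (hr : IsSmoothOnHalfSpace r) (hvE : HasBoundedEnergy v) :
    ∀ t ∈ Icc 0 T, v t = w t := by
  have hLHv : IsLerayHopfOn T ν f (w 0) v :=
    (isGlobalLerayHopf_of_claySolution hP hL hν hs hd hsol hv hr hvE).1 T hT
  have hLHw : IsLerayHopfOn T ν f (w 0) w := (isLerayHopfOn_of_clayForce hP hL hw hν hT hs hd hwE).1
  have hf : ∀ T', 0 < T' → T' < T → MemLqLp 1 2 f (Ioo 0 T') :=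
    fun T' _ _ => clayForce_memLqLp_one_two hs hd T'
  have hae : ∀ t ∈ Ioo 0 T, w t =ᵐ[volume] v t := hSM.of_L4L6 hν hT hf hLHv hLHw hS
  -- the competitor is classical on `[0, ∞)`
  obtain ⟨hcl, -⟩ := isNavierStokesSolution_and_smooth_iff.1 ⟨hsol, hv, hr⟩
  have hvT : IsClassicalNSSolutionOn (Icc 0 T) ν f v r :=
    hcl.mono Icc_subset_Ici_self (uniqueDiffOn_Icc hT)
  -- a.e. to everywhere on `(0, T)`, by continuity in `x`
  have hIoo : ∀ t ∈ Ioo 0 T, v t = w t := by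
    intro t ht
    have htI : t ∈ Icc 0 T := Ioo_subset_Icc_self ht
    exact ((Continuous.ae_eq_iff_eq volume (hvT.contDiff_velocity htI).continuous
      (hw.contDiff_velocity htI).continuous).1 (hae t ht).symm)
  -- to the closed slab, by continuity in `t` for each `x`
  intro t ht
  funext x
  have hcv : ContinuousOn (fun s => v s x) (Icc 0 T) :=
    hvT.smooth_velocity.continuousOn.comp ((continuous_id.prodMk continuous_const).continuousOn)
      fun s hs => mk_mem_prod hs (mem_univ x)
  have hcw : ContinuousOn (fun s => w s x) (Icc 0 T) :=
    hw.smooth_velocity.continuousOn.comp ((continuous_id.prodMk continuous_const).continuousOn)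
      fun s hs => mk_mem_prod hs (mem_univ x)
  have hEq : EqOn (fun s => v s x) (fun s => w s x) (Ioo 0 T) := fun s hs => by
    simp only [hIoo s hs]
  have hcl' : Icc 0 T ⊆ closure (Ioo 0 T) := by rw [closure_Ioo hT.ne]
  exact hEq.of_subset_closure hcv hcw Ioo_subset_Icc_self hcl' ht

end Summit.NavierStokesRegularity.FluidComputer.ClayForcedLerayHopf

end
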